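import Mathlib
import Literature.MathematicalPhysics.QuantumFieldTheory.Balaban1983to89.T4EtaRateCoeffDefect
import HarnessLib

/-!
# Route «BalabanUVNodes» (cluster K4 «SpineRates»), Track-A DAG node N15 = spine estimate NE2 «η-rate of the background-dependent
# linear theory», BACKGROUND LAYER — FIRST MISSING ESTIMATE, part 1/3: THE η-DEFECT OF THE LATTICE DERIVATIVE UNDER THE
# PIECEWISE-CONSTANT PULL-BACK (exact face-supported formula; discrete integration along block lines)

Cell `pub-ymgap`, seat `pub-ymgap-dag-n15-b` (FIRST-MISSING-ESTIMATE, HUMAN RULING D-0062 «Track A at full width»; chair R424 venue,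
R429 «START HERE»; YM-PLAN v0.12.15 §2c row N15; `pub-balaban-gaps/BALABAN-GAPS.md` v1.0 §C row NE2; dag-lead NODE-TABLE v1 row n15
«background-layer estimate → n15-b»).  `bears_on: R4∕N15`.  Filed `--supports stmt-QuantumFields-19351` (spine leaf `BalabanLadder.UV`)
until the node stub `S_N15` of route «BalabanUVNodes» (K4, under item `SpineGivenEndpoint`) is an item.

WHAT N15 IS.  Statement of record (venue `HOME/lean/ym-dag/N15_NE2.lean`, dagwriter `YMDAG.UVSplit.N15At`):
`T4EtaRate.NE2PlusOperator c35 pi Kop ∧ NE2PlusSite 4 p c35 pi Ksite ∧ NE2PlusUnit c35 pi Kunit inΛ unitDist` — NOT PRINTED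
([Balaban1985BackgroundPropagators] Thm 3.1 p. 397 ∕ Thm 3.15 p. 432 print UNIFORMITY in the spacing, never an η-difference; King,
CMP 102 (1986) Lemma 4.5 (4.38) p. 674 is the printed scalar `A = 0` model).  The «printed proof» this seat walks is therefore the cell
record `pub-balaban/t4/T4-EST-U1a.md` §3 (STEPs 0–4, every printed input cited by page); the BACKGROUND LAYER is its STEP 2
(NE2-LOCAL-A) + STEP 4 (NE2-LIP).  In the tree before this file: STEP 0∕3 as mechanism (`T4EtaRateDefect`, `T4EtaRateDefectSite`), and
the COEFFICIENT half of STEP 2 (`T4EtaRateCoeffDefect`, p193236).  The record's own located next atom (§16, item S5, verbatim): *«the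
OPERATOR ingredient of NE2-LOCAL-A in its smallest honest form: the defect of the forward difference quotient ∇^{η′}_μ vs ∇^{η}_μ under
`pull π` … EXACT formula first (it is supported on the block-FACE bonds …), then its majorant ONLY INSIDE COMPOSITES … the place where
«small only inside composites» must be earned, not assumed»*.  THIS THREE-PART MODULE IS THAT ITEM, kernel-checked:
part 1 (this file) = the exact algebra; part 2 (`…N15DerivDefectMajorant`) = the estimate inside composites in the block-majorant currency
of `B11SectG`; part 3 (`…N15DerivDefectLattices`) = the instances `ℤ^d` ∕ circle ∕ torus and the sharpness witness.

THE PRINT USED (SHAPES only, quoted from the cross-read tree header `B9.lean`; nothing of [B9] is asserted).  Thm 3.1 (3.42) p. 397: the four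
sup entries *«|(G′λ)(x)|, |(∇_U G′λ)(x)|, |(G′∇*_U λ)(x)|, |(Δ_U G′λ)(x)|»* with prefactors `[(L^jη)², L^jη, L^jη, 1]` (`B9.pref4`) — the THIRD
entry (the operator followed by the ADJOINT covariant derivative) is the shape through which a fine left factor sees the defect (§4,
`comp_idef_fdiffN_comp`); (3.50)–(3.53) p. 400 (*«Δ_{U′U} = Δ_U − V′₁(A)»*, `V₁` first order in the derivatives) as MECHANISM; King p. 664
(*«When x′ ∈ T_{η′}, we denote by x that point in T_η for which x′ ∈ B^n(x)»*) — the pairing whose piecewise-constant pull-back is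
`T4EtaRateCoeffDefect.pull` (convention (C2) of the record).

CONTENTS (all [folklore]: linear algebra and finite combinatorics over hypothesis-shaped data).
* §1 `fdiff s = pull s − id` (`f(s x) − f(x)`), its ADJOINT `bdiff s = pull s⁻¹ − id` for an invertible shift (`sum_fdiff_mul`: discrete
  integration by parts), the normalised quotients `fdiffN η s = η⁻¹•fdiff s`, `bdiffN`.
* §2 `LineData X X′`: fine shift `s′ : X′ ≃ X′`, block projection `π`, coarse shift `s`, spacing ratio `M ≥ 1`, DEPTH `dep x′ < M` of a fine site
  on its line inside its block, and the four bookkeeping axioms (below the face `s′` keeps `π` and raises `dep`; from the face `dep + 1 = M`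
  it enters the block `s(πx′)` at depth `0`); the face weight `chi = M·1_{face} − 1` and the STAIRCASE `stair = M_{(dep+1)·1_{¬face}} ∘ pull π`.
* §3 EXACT DEFECT FORMULA: `fdiff s′ (pull π f) = 1_{face}·pull π (fdiff s f)`; `𝔇(∇′_{η′}, ∇_η) = M_χ ∘ pull π ∘ ∇_η` for `Mη′ = η`
  (`idef_fdiffN_eq`) — ORDER ONE pointwise, `O(M) = O(η∕η′)` on the faces: NOT small.
* §4 DISCRETE INTEGRATION: `bdiff s′ ∘ stair = M_χ ∘ pull π` (`bdiff_comp_stair`); hence `Σ χ·(f∘π)·g = Σ (stair f)·(∇′g)` and zero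
  line∕total sums, and INSIDE COMPOSITES `S′ ∘ 𝔇(∇′_{η′}, ∇_η) ∘ G = (S′ ∘ ∇′*_{η′}) ∘ (η′•stair) ∘ (∇_η ∘ G)` for EVERY fine left factor
  `S′` and coarse right factor `G` — the Leibniz summand of `T4EtaRateDefect.idef_comp` is seen by `S′` only through its adjoint-derivative
  entry, at the price of the factor `η′` carried by a staircase of height `≤ M − 1` (part 2: `η′(M − 1) ≤ η` = ONE rate factor `η∕ℓ`).

HONEST FRAMING ∕ LIMITS.  MECHANISM ONLY: lattices, projections, shifts are data; nothing about Bałaban's `G′(U)`, `∇_U`, `A` is asserted;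
the FLAT difference `f(x + e_μ) − f(x)` only (the covariant one differs by a multiplication operator = the coefficient half); no instance
against the actual [B6]∕[B9] expansions (S6 of the record NOT attempted).  NE2⁺ NOT PRINTED, NOT proved, class word WORK-bound unchanged;
count-neutral (typed 28∕28 · discharged 0∕28); one finite T⁴ at fixed ε — NOT infinite volume, NOT OS on ℝ⁴, NOT a mass gap, NOT Clay.
-/

noncomputable section

namespace Summit.QuantumFields.YangMills.BalabanUVNodes.N15.DerivDefect

open Literature.MathematicalPhysics.QuantumFieldTheory.Balaban1983to89
open Literature.MathematicalPhysics.QuantumFieldTheory.Balaban1983to89.B11SectG (BlockNorm HasMaj hasMaj_comp)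
open Literature.MathematicalPhysics.QuantumFieldTheory.Balaban1983to89.T4EtaRateDefect (idef)
open Literature.MathematicalPhysics.QuantumFieldTheory.Balaban1983to89.T4EtaRateCoeffDefect (pull pull_apply diagK
  diagK_same diagK_ne diagK_nonneg loc_fine_mul_pull_le)
open Literature.MathematicalPhysics.QuantumFieldTheory.Balaban1983to89.B11AxialTransport190 (abs_le_loc_ofBlocks
  loc_ofBlocks_le)
open Literature.MathematicalPhysics.QuantumFieldTheory.Balaban1983to89.B6Prop26Gluing (mulOp mulOp_apply)
open Literature.MathematicalPhysics.QuantumLattice (blockMap)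

/-! ## §1 Lattice differences along a shift and their adjoints -/

section Shift

variable {X : Type}

/-- The (unnormalised) FORWARD DIFFERENCE along a shift `s`: `(fdiff s f)(x) = f(s x) − f(x)` — on `ℤ^d` with
`s = · + e_μ` the flat lattice derivative `ηꞏ∇^η_μ`. [folklore] -/
def fdiff (s : X → X) : (X → ℝ) →ₗ[ℝ] (X → ℝ) := pull s - LinearMap.id

/-- Pointwise form of the forward difference. [folklore] -/
@[simp] theorem fdiff_apply (s : X → X) (f : X → ℝ) (x : X) : fdiff s f x = f (s x) - f x := rfl

/-- The (unnormalised) BACKWARD DIFFERENCE along an invertible shift: `(bdiff s g)(x) = g(s⁻¹ x) − g(x)` — the lattice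
ADJOINT `ηꞏ∇^{η*}_μ` of the forward difference (`sum_fdiff_mul`). [folklore] -/
def bdiff (s : X ≃ X) : (X → ℝ) →ₗ[ℝ] (X → ℝ) := pull s.symm - LinearMap.id

/-- Pointwise form of the backward difference. [folklore] -/
@[simp] theorem bdiff_apply (s : X ≃ X) (g : X → ℝ) (x : X) : bdiff s g x = g (s.symm x) - g x := rfl

/-- The NORMALISED forward difference quotient `∇^η = η⁻¹ꞏ(f(s x) − f(x))`. [folklore] -/
def fdiffN (η : ℝ) (s : X → X) : (X → ℝ) →ₗ[ℝ] (X → ℝ) := η⁻¹ • fdiff s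

/-- Pointwise form. [folklore] -/
@[simp] theorem fdiffN_apply (η : ℝ) (s : X → X) (f : X → ℝ) (x : X) :
    fdiffN η s f x = η⁻¹ * (f (s x) - f x) := rfl

/-- The NORMALISED backward (adjoint) difference quotient `∇^{η*} = η⁻¹ꞏ(g(s⁻¹x) − g(x))`. [folklore] -/
def bdiffN (η : ℝ) (s : X ≃ X) : (X → ℝ) →ₗ[ℝ] (X → ℝ) := η⁻¹ • bdiff s

/-- Pointwise form. [folklore] -/
@[simp] theorem bdiffN_apply (η : ℝ) (s : X ≃ X) (g : X → ℝ) (x : X) :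
    bdiffN η s g x = η⁻¹ * (g (s.symm x) - g x) := rfl

/-- `bdiffN η s = η⁻¹ • bdiff s` composed on the left: `bdiffN η s ∘ (η • T) = bdiff s ∘ T` (`η ≠ 0`). [folklore] -/
theorem bdiffN_comp_smul {F : Type} [AddCommGroup F] [Module ℝ F] {η : ℝ} (hη : η ≠ 0) (s : X ≃ X)
    (T : F →ₗ[ℝ] (X → ℝ)) : bdiffN η s ∘ₗ (η • T) = bdiff s ∘ₗ T := by
  ext v x
  simp only [LinearMap.comp_apply, LinearMap.smul_apply, bdiffN_apply, Pi.smul_apply, smul_eq_mul, bdiff_apply]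
  field_simp

variable [Fintype X]

/-- DISCRETE INTEGRATION BY PARTS: `Σ_x (∇f)(x)ꞏg(x) = Σ_x f(x)ꞏ(∇*g)(x)` for an invertible shift on a finite
lattice (reindex the shifted sum by the bijection). [folklore] -/
theorem sum_fdiff_mul (s : X ≃ X) (f g : X → ℝ) :
    ∑ x, fdiff s f x * g x = ∑ x, f x * bdiff s g x := by
  have hre : ∑ x, f (s x) * g x = ∑ x, f x * g (s.symm x) := by
    have := Equiv.sum_comp s (fun x => f x * g (s.symm x))
    simpa using this
  simp only [fdiff_apply, bdiff_apply, sub_mul, mul_sub, Finset.sum_sub_distrib, hre]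

/-- The same with the roles exchanged: `Σ_x (∇*g)(x)ꞏf(x) = Σ_x g(x)ꞏ(∇f)(x)`. [folklore] -/
theorem sum_bdiff_mul (s : X ≃ X) (g f : X → ℝ) :
    ∑ x, bdiff s g x * f x = ∑ x, g x * fdiff s f x := by
  rw [show (∑ x, g x * fdiff s f x) = ∑ x, fdiff s f x * g x from Finset.sum_congr rfl fun x _ => mul_comm _ _,
    sum_fdiff_mul]
  exact Finset.sum_congr rfl fun x _ => mul_comm _ _

end Shift

/-! ## §2 Block-line data: the depth of a fine site along its line inside its block -/

/-- BLOCK-LINE DATA for one lattice direction of an η-pairing (NOT PRINTED as such; the one printed convention is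
King's for lattice points).  `X` = coarse sites, `X′` = fine sites, `π` the block projection, `s` / `s′` the unit shifts
of the coarse / fine lattice in the chosen direction (`s′` invertible: a torus or all of `ℤ^d`), `M ≥ 1` the spacing ratio
(the blocks are segments of `M` consecutive fine sites along every line), `dep x′` the position of `x′` on that segment.
Axioms: positions are `< M`; below the face (`dep + 1 < M`) the fine shift stays in the block and raises the position;
from the face (`dep + 1 = M`) it enters the NEXT block `s(πx′)` at position `0`. [cite: King1986, p.664 (pairing convention «x′ ∈ B^n(x)»)] -/
structure LineData (X X' : Type) where
  M : ℕ
  M_pos : 0 < M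
  π : X' → X
  s : X → X
  s' : X' ≃ X'
  dep : X' → ℕ
  dep_lt : ∀ x', dep x' < M
  π_succ_of_lt : ∀ x', dep x' + 1 < M → π (s' x') = π x'
  dep_succ_of_lt : ∀ x', dep x' + 1 < M → dep (s' x') = dep x' + 1
  π_succ_of_eq : ∀ x', dep x' + 1 = M → π (s' x') = s (π x')
  dep_succ_of_eq : ∀ x', dep x' + 1 = M → dep (s' x') = 0

namespace LineData

variable {X X' : Type} (D : LineData X X')

/-- A site not on the face lies strictly below it. [folklore] -/
theorem succ_lt_of_ne {x' : X'} (h : D.dep x' + 1 ≠ D.M) : D.dep x' + 1 < D.M :=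
  lt_of_le_of_ne (Nat.succ_le_of_lt (D.dep_lt x')) h

/-- `1 ≤ M` as a real inequality. [folklore] -/
theorem one_le_M_real : (1 : ℝ) ≤ D.M := by exact_mod_cast D.M_pos

/-- PREDECESSOR OF A DEPTH-ZERO SITE: it is the face of the previous block. [folklore] -/
theorem dep_pred_of_zero {x' : X'} (h0 : D.dep x' = 0) : D.dep (D.s'.symm x') + 1 = D.M := by
  by_contra hne
  have hlt := D.succ_lt_of_ne hne
  have hstep := D.dep_succ_of_lt _ hlt
  rw [Equiv.apply_symm_apply] at hstep
  omega

/-- PREDECESSOR OF A SITE OF POSITIVE DEPTH: it lies in the same block, one position lower. [folklore] -/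
theorem pred_of_pos {x' : X'} (hpos : 0 < D.dep x') :
    D.dep (D.s'.symm x') + 1 < D.M ∧ D.dep x' = D.dep (D.s'.symm x') + 1 ∧ D.π (D.s'.symm x') = D.π x' := by
  have hlt : D.dep (D.s'.symm x') + 1 < D.M := by
    by_contra hge
    have heq : D.dep (D.s'.symm x') + 1 = D.M :=
      le_antisymm (Nat.succ_le_of_lt (D.dep_lt _)) (not_lt.mp hge)
    have h0 := D.dep_succ_of_eq _ heq
    rw [Equiv.apply_symm_apply] at h0
    omega
  refine ⟨hlt, ?_, ?_⟩
  · have h := D.dep_succ_of_lt _ hlt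
    rwa [Equiv.apply_symm_apply] at h
  · have h := D.π_succ_of_lt _ hlt
    rw [Equiv.apply_symm_apply] at h
    exact h.symm

/-- THE FACE WEIGHT `χ = Mꞏ1_{face} − 1`: `M − 1` on the face, `−1` below it. [folklore] -/
def chi (x' : X') : ℝ := if D.dep x' + 1 = D.M then (D.M : ℝ) - 1 else -1

/-- THE STAIRCASE COEFFICIENT `(dep + 1)ꞏ1_{not face}` — the partial sums of `−χ` along the line. [folklore] -/
def stairCoeff (x' : X') : ℝ := if D.dep x' + 1 = D.M then 0 else (D.dep x' : ℝ) + 1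

/-- `|χ| ≤ M − 1` (off the face `M ≥ 2`, so `|−1| ≤ M − 1`). [folklore] -/
theorem abs_chi_le (x' : X') : |D.chi x'| ≤ (D.M : ℝ) - 1 := by
  unfold chi
  split_ifs with h
  · rw [abs_of_nonneg (by linarith [D.one_le_M_real])]
  · have h2 : (2 : ℝ) ≤ D.M := by exact_mod_cast (show 2 ≤ D.M by have := D.succ_lt_of_ne h; omega)
    rw [abs_neg, abs_one]
    linarith

/-- `0 ≤ stairCoeff ≤ M − 1`. [folklore] -/
theorem stairCoeff_nonneg (x' : X') : 0 ≤ D.stairCoeff x' := by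
  unfold stairCoeff
  split_ifs
  · exact le_rfl
  · positivity

/-- see `stairCoeff_nonneg`. [folklore] -/
theorem stairCoeff_le (x' : X') : D.stairCoeff x' ≤ (D.M : ℝ) - 1 := by
  unfold stairCoeff
  split_ifs with h
  · linarith [D.one_le_M_real]
  · have hlt := D.succ_lt_of_ne h
    have : (D.dep x' : ℝ) + 1 + 1 ≤ D.M := by exact_mod_cast hlt
    linarith

/-- `|stairCoeff| ≤ M − 1`. [folklore] -/
theorem abs_stairCoeff_le (x' : X') : |D.stairCoeff x'| ≤ (D.M : ℝ) - 1 := by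
  rw [abs_of_nonneg (D.stairCoeff_nonneg x')]
  exact D.stairCoeff_le x'

/-- THE STAIRCASE OPERATOR `Φ f (x′) = stairCoeff(x′)ꞏf(πx′)` (coarse functions to fine functions). [folklore] -/
def stair : (X → ℝ) →ₗ[ℝ] (X' → ℝ) := mulOp D.stairCoeff ∘ₗ pull D.π

/-- Pointwise form of the staircase. [folklore] -/
@[simp] theorem stair_apply (f : X → ℝ) (x' : X') : D.stair f x' = D.stairCoeff x' * f (D.π x') := rfl

end LineData

/-! ## §3 The exact defect formula: the fine difference of a pulled-back function lives on the face bonds -/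

section Exact

variable {X X' : Type} (D : LineData X X')

/-- `∇′(pull π f)(x′) = 1_{face}(x′)ꞏ(∇f)(πx′)`: zero on in-block bonds, the coarse difference on face bonds. [folklore] -/
theorem fdiff_pull_apply (f : X → ℝ) (x' : X') :
    fdiff D.s' (pull D.π f) x' = (if D.dep x' + 1 = D.M then 1 else 0) * fdiff D.s f (D.π x') := by
  simp only [fdiff_apply, pull_apply]
  by_cases h : D.dep x' + 1 = D.M
  · rw [D.π_succ_of_eq x' h, if_pos h, one_mul]
  · rw [D.π_succ_of_lt x' (D.succ_lt_of_ne h), if_neg h, zero_mul, sub_self]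

/-- As operators: `∇′ ∘ pull π = M_{1_face} ∘ pull π ∘ ∇`. [folklore] -/
theorem fdiff_comp_pull :
    fdiff D.s' ∘ₗ pull D.π =
      mulOp (fun x' => if D.dep x' + 1 = D.M then (1 : ℝ) else 0) ∘ₗ pull D.π ∘ₗ fdiff D.s := by
  ext f x'
  simp only [LinearMap.comp_apply, fdiff_pull_apply, mulOp_apply, pull_apply]

/-- THE EXACT DEFECT FORMULA (unnormalised): `𝔇(∇′, ∇) = ∇′∘pull − pull∘∇ = M_{1_face − 1} ∘ pull π ∘ ∇`. [folklore] -/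
theorem idef_fdiff_eq :
    idef (pull D.π) (pull D.π) (fdiff D.s') (fdiff D.s) =
      mulOp (fun x' => if D.dep x' + 1 = D.M then (0 : ℝ) else -1) ∘ₗ pull D.π ∘ₗ fdiff D.s := by
  ext f x'
  simp only [T4EtaRateDefect.idef_apply, LinearMap.comp_apply, mulOp_apply, Pi.sub_apply, fdiff_pull_apply, pull_apply]
  split_ifs <;> ring

/-- THE EXACT DEFECT FORMULA for the difference QUOTIENTS of two spacings `η = Mη′` (coarse `η`, fine `η′`):
`𝔇(∇′_{η′}, ∇_η)(f)(x′) = χ(x′)ꞏ(∇_η f)(πx′)`, `χ = Mꞏ1_{face} − 1` — of order ONE below the faces and of order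
`M = η/η′` on them: NOT small pointwise. [folklore] -/
theorem idef_fdiffN_apply {η η' : ℝ} (hη' : η' ≠ 0) (hMη : (D.M : ℝ) * η' = η) (f : X → ℝ) (x' : X') :
    idef (pull D.π) (pull D.π) (fdiffN η' D.s') (fdiffN η D.s) f x' = D.chi x' * fdiffN η D.s f (D.π x') := by
  have hM : (D.M : ℝ) ≠ 0 := by exact_mod_cast D.M_pos.ne'
  have hη : η ≠ 0 := by rw [← hMη]; exact mul_ne_zero hM hη'
  have key : fdiffN η' D.s' (pull D.π f) x' =
      (if D.dep x' + 1 = D.M then 1 else 0) * (η'⁻¹ * (f (D.s (D.π x')) - f (D.π x'))) := by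
    have h := fdiff_pull_apply D f x'
    simp only [fdiff_apply, pull_apply] at h
    simp only [fdiffN_apply, pull_apply, h]
    ring
  simp only [T4EtaRateDefect.idef_apply, Pi.sub_apply, key, pull_apply, fdiffN_apply, LineData.chi]
  have hinv : η'⁻¹ = (D.M : ℝ) * η⁻¹ := by
    rw [← hMη, mul_inv, ← mul_assoc, mul_inv_cancel₀ hM, one_mul]
  rw [hinv]
  split_ifs <;> ring

/-- THE EXACT DEFECT FORMULA, as operators: `𝔇(∇′_{η′}, ∇_η) = M_χ ∘ pull π ∘ ∇_η`. [folklore] -/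
theorem idef_fdiffN_eq {η η' : ℝ} (hη' : η' ≠ 0) (hMη : (D.M : ℝ) * η' = η) :
    idef (pull D.π) (pull D.π) (fdiffN η' D.s') (fdiffN η D.s) = mulOp D.chi ∘ₗ pull D.π ∘ₗ fdiffN η D.s := by
  ext f x'
  rw [idef_fdiffN_apply D hη' hMη]
  rfl

end Exact

/-! ## §4 Discrete integration along block lines: `M_χ ∘ pull π = ∇′* ∘ Φ` -/

section Stair

variable {X X' : Type} (D : LineData X X')

/-- THE STAIRCASE IDENTITY, pointwise: `(∇′*Φf)(x′) = χ(x′)ꞏf(πx′)` — the face-weighted pull-back IS the backward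
difference of the staircase (on each line segment of a block `χ = (−1,…,−1, M−1)` has partial sums `−(dep+1)` vanishing at
the face). [folklore] -/
theorem bdiff_stair_apply (f : X → ℝ) (x' : X') : bdiff D.s' (D.stair f) x' = D.chi x' * f (D.π x') := by
  simp only [bdiff_apply, LineData.stair_apply]
  rcases Nat.eq_zero_or_pos (D.dep x') with h0 | hpos
  · -- depth 0: the predecessor is the face of the previous block, where the staircase vanishes
    have hp : D.dep (D.s'.symm x') + 1 = D.M := D.dep_pred_of_zero h0
    have hsc : D.stairCoeff (D.s'.symm x') = 0 := by simp [LineData.stairCoeff, hp]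
    rw [hsc, zero_mul, zero_sub]
    by_cases hM : D.dep x' + 1 = D.M
    · -- then M = 1: every site is a face, χ = 0 and the staircase vanishes
      have hM1 : (D.M : ℝ) = 1 := by exact_mod_cast (show D.M = 1 by omega)
      simp [LineData.stairCoeff, LineData.chi, hM, hM1]
    · have hne : ¬ (1 = D.M) := by omega
      simp [LineData.stairCoeff, LineData.chi, h0, hne]
  · obtain ⟨hplt, hdep, hπ⟩ := D.pred_of_pos hpos
    have hsc : D.stairCoeff (D.s'.symm x') = (D.dep (D.s'.symm x') : ℝ) + 1 := by
      simp [LineData.stairCoeff, hplt.ne]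
    rw [hsc, hπ]
    by_cases hM : D.dep x' + 1 = D.M
    · have hx : D.stairCoeff x' = 0 := by simp [LineData.stairCoeff, hM]
      have hc : D.chi x' = (D.M : ℝ) - 1 := by simp [LineData.chi, hM]
      have hval : (D.dep (D.s'.symm x') : ℝ) + 1 = (D.M : ℝ) - 1 := by
        have h2 : D.dep (D.s'.symm x') + 1 + 1 = D.M := by omega
        have h2' : ((D.dep (D.s'.symm x') + 1 + 1 : ℕ) : ℝ) = D.M := by exact_mod_cast h2
        push_cast at h2'
        linarith
      rw [hx, hc, hval]
      ring
    · have hx : D.stairCoeff x' = (D.dep x' : ℝ) + 1 := by simp [LineData.stairCoeff, hM]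
      have hc : D.chi x' = -1 := by simp [LineData.chi, hM]
      rw [hx, hc, hdep]
      push_cast
      ring

/-- THE STAIRCASE IDENTITY, as operators: `∇′* ∘ Φ = M_χ ∘ pull π`. [folklore] -/
theorem bdiff_comp_stair : bdiff D.s' ∘ₗ D.stair = mulOp D.chi ∘ₗ pull D.π := by
  ext f x'
  simp only [LinearMap.comp_apply, bdiff_stair_apply, mulOp_apply, pull_apply]

/-- The defect of the difference quotients FACTORS THROUGH THE FINE ADJOINT DERIVATIVE:
`𝔇(∇′_{η′}, ∇_η) = ∇′* ∘ Φ ∘ ∇_η` (unnormalised `∇′*`). [folklore] -/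
theorem idef_fdiffN_eq_bdiff_stair {η η' : ℝ} (hη' : η' ≠ 0) (hMη : (D.M : ℝ) * η' = η) :
    idef (pull D.π) (pull D.π) (fdiffN η' D.s') (fdiffN η D.s) = bdiff D.s' ∘ₗ D.stair ∘ₗ fdiffN η D.s := by
  rw [idef_fdiffN_eq D hη' hMη, ← LinearMap.comp_assoc, ← bdiff_comp_stair D, LinearMap.comp_assoc]

/-- THE IDENTITY INSIDE COMPOSITES: for every fine left factor `S′` and coarse right factor `G`,
`S′ ∘ 𝔇(∇′_{η′}, ∇_η) ∘ G = (S′ ∘ ∇′*_{η′}) ∘ (η′•Φ) ∘ (∇_η ∘ G)` — the defect is seen by `S′` only through its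
ADJOINT-DERIVATIVE entry, at the cost of the factor `η′` carried by the staircase. [folklore] -/
theorem comp_idef_fdiffN_comp {F₁ F₃ : Type} [AddCommGroup F₁] [Module ℝ F₁] [AddCommGroup F₃] [Module ℝ F₃]
    {η η' : ℝ} (hη' : η' ≠ 0) (hMη : (D.M : ℝ) * η' = η) (S' : (X' → ℝ) →ₗ[ℝ] F₃) (G : F₁ →ₗ[ℝ] (X → ℝ)) :
    S' ∘ₗ idef (pull D.π) (pull D.π) (fdiffN η' D.s') (fdiffN η D.s) ∘ₗ G =
      (S' ∘ₗ bdiffN η' D.s') ∘ₗ ((η' • D.stair) ∘ₗ (fdiffN η D.s ∘ₗ G)) := by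
  rw [idef_fdiffN_eq_bdiff_stair D hη' hMη]
  have h : bdiffN η' D.s' ∘ₗ (η' • D.stair) = bdiff D.s' ∘ₗ D.stair := bdiffN_comp_smul hη' D.s' D.stair
  ext v
  have h' := LinearMap.congr_fun h (fdiffN η D.s (G v))
  simp only [LinearMap.comp_apply] at h' ⊢
  rw [h']

variable [Fintype X']

/-- THE DEFECT INTEGRATES THROUGH THE DERIVATIVE: `Σ_{x′} χ(x′)f(πx′)ꞏg(x′) = Σ_{x′} (Φf)(x′)ꞏ(∇′g)(x′)`. [folklore] -/
theorem sum_chi_pull_mul (f : X → ℝ) (g : X' → ℝ) :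
    ∑ x', D.chi x' * f (D.π x') * g x' = ∑ x', D.stair f x' * fdiff D.s' g x' := by
  rw [← sum_bdiff_mul]
  exact Finset.sum_congr rfl fun x' _ => by rw [bdiff_stair_apply]

/-- ZERO TOTAL (and, with `f` the indicator of one coarse site, ZERO BLOCK SUMS): `Σ_{x′} χ(x′)f(πx′) = 0`. [folklore] -/
theorem sum_chi_pull_eq_zero (f : X → ℝ) : ∑ x', D.chi x' * f (D.π x') = 0 := by
  have h := sum_chi_pull_mul D f (fun _ => 1)
  simp only [mul_one, fdiff_apply, sub_self, mul_zero, Finset.sum_const_zero] at h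
  exact h

end Stair

end Summit.QuantumFields.YangMills.BalabanUVNodes.N15.DerivDefect
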